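import Summits.QuantumFields.BalabanUV.T4Continuum.Support.NE7SecondOrderChainRuleVec
import HarnessLib

/-!
# NE7TowerSecondOrderChainRule — THE SECOND DERIVATIVE OF A TOWER OF MAPS IS THE LEVEL SUM OF THE ONE-STEP SECOND DERIVATIVES PUSHED UP BY THE LINEARISED TOWER:
# for `C²` maps `φ_s : E → E` with `φ_s(0) = 0` and the composites `Ψ_0 = id`, `Ψ_{s+1} = φ_s ∘ Ψ_s`,
# `D²Ψ_T(0)[x,x′] = Σ_{s<T} (Dφ_{T−1}(0)∘⋯∘Dφ_{s+1}(0)) [D²φ_s(0)[DΨ_s(0)x, DΨ_s(0)x′]]`, `DΨ_s(0) = Dφ_{s−1}(0)∘⋯∘Dφ_0(0)`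
# (lineage `b2b-balaban-t4-ne7-p1`, gen 119, file H2; memo ROAD-G119 §2 «(G′) via the stripped tower», step (3))

Cell `pub-balaban`, rung (B)+1 sub-cell t4, CRUX PROVER NE7 #1 (OWNER of row NE7), generation 119.
WHY (memo ROAD-G119 §2).  The STRIPPED (double-bar) `(j+1)`-fold average of [Balaban1985Averaging] (90)–(91) is, in exponential coordinates around the background tower
`W_s = cavgIter s U♯`, a composition of one-step maps `ψ ↦ φ_s(ψ) = log(W̄_s⁻¹·\overline{\overline{R(W_s)(W_se^{ψ})}})` with `φ_s(0) = 0` and LINEAR PART `Dφ_s(0) = Qbar L W_s`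
(✓ `NE3TangentCovariantStructure.Qbar`, the straight average (120)), hence `DΨ_s(0) = QbarIter L s U♯` — the mass-contracting straight tower.  With H1
(✓∕pending `NE7BorderedMultiplierTransport`: on top-frame-free directions the multiplier term of the bordered Hessian is `Dm(0)[D²Ψ_{j+1}(0)[X,X]]`) the level sum of THIS FILE feeds
row NE7b's multiplier density `|Dm(0)[u]| ≤ ε·c·‖u‖_{ℓ¹}` and the `ℓ¹`-contraction of the straight tower: `|Dm(0)[D²Ψ(0)[X,X]]| ≤ ε·c·Σ_s (L∕L⁴)^{j−s}·‖D²φ_s(0)[S_s,S_s]‖_{ℓ¹}`,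
`S_s = QbarIter_s X̃`, with NO frame terms.  THIS FILE is the pure-calculus level sum (any real normed space; no T⁴ object).
WHAT ([folklore]; 0 sorry): `towerMap φ T` (the composite `Ψ_T`), `towerLin A a b` (the product `A_{a+b−1}∘⋯∘A_a` of continuous linear maps), `towerMap_zero_apply`, `towerLin_succ_left`
(peeling the FIRST factor), `contDiffAt_towerMap`, `fderiv_towerMap` (`DΨ_T(0) = towerLin (Dφ·(0)) 0 T`), and **`fderiv_fderiv_towerMap`** (the displayed level sum).
HONEST FRAMING (page 1): elementary calculus; nothing of Bałaban's asserted ((90)–(91), (120) context only); NOT (G′), NOT NE7 as a spine node; spine 0∕9; finite T⁴ rung (B)+1 — NOT infinite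
volume, NOT mass gap, NOT BetaPertH, NOT Clay.
-/

set_option autoImplicit false

open scoped Topology BigOperators
open Filter Finset

namespace Summit.QuantumFields.BalabanUV.T4Continuum.NE7TowerSecondOrderChainRule

open NE7SecondOrderChainRuleVec (fderiv_fderiv_comp_vec)

variable {E : Type*} [NormedAddCommGroup E] [NormedSpace ℝ E]

/-- THE TOWER OF COMPOSITES: `towerMap φ 0 = id`, `towerMap φ (s+1) = φ s ∘ towerMap φ s`. [folklore] -/
def towerMap (φ : ℕ → E → E) : ℕ → E → E
  | 0 => id
  | s + 1 => fun x => φ s (towerMap φ s x)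

/-- THE LINEARISED TOWER between levels `a` and `a + b`: `towerLin A a 0 = id`, `towerLin A a (b+1) = A (a+b) ∘ towerLin A a b`. [folklore] -/
def towerLin (A : ℕ → E →L[ℝ] E) (a : ℕ) : ℕ → E →L[ℝ] E
  | 0 => ContinuousLinearMap.id ℝ E
  | b + 1 => (A (a + b)).comp (towerLin A a b)

omit [NormedAddCommGroup E] [NormedSpace ℝ E] in
/-- `towerMap φ 0 x = x`. [folklore] -/
@[simp] theorem towerMap_zero_apply (φ : ℕ → E → E) (x : E) : towerMap φ 0 x = x := rfl

omit [NormedAddCommGroup E] [NormedSpace ℝ E] in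
/-- `towerMap φ (s+1) x = φ s (towerMap φ s x)`. [folklore] -/
theorem towerMap_succ_apply (φ : ℕ → E → E) (s : ℕ) (x : E) : towerMap φ (s + 1) x = φ s (towerMap φ s x) := rfl

/-- `towerLin A a 0 = id`. [folklore] -/
@[simp] theorem towerLin_zero (A : ℕ → E →L[ℝ] E) (a : ℕ) : towerLin A a 0 = ContinuousLinearMap.id ℝ E := rfl

/-- `towerLin A a (b+1) = A (a+b) ∘ towerLin A a b`. [folklore] -/
theorem towerLin_succ (A : ℕ → E →L[ℝ] E) (a b : ℕ) : towerLin A a (b + 1) = (A (a + b)).comp (towerLin A a b) := rfl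

/-- Peeling the FIRST factor: `towerLin A a (b+1) = towerLin A (a+1) b ∘ A a`. [folklore] -/
theorem towerLin_succ_left (A : ℕ → E →L[ℝ] E) (a : ℕ) : ∀ b : ℕ, towerLin A a (b + 1) = (towerLin A (a + 1) b).comp (A a)
  | 0 => by
    rw [towerLin_succ, towerLin_zero, towerLin_zero, Nat.add_zero, ContinuousLinearMap.comp_id, ContinuousLinearMap.id_comp]
  | b + 1 => by
    rw [towerLin_succ, towerLin_succ_left A a b, towerLin_succ, ContinuousLinearMap.comp_assoc,
      show a + (b + 1) = a + 1 + b by omega]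

omit [NormedSpace ℝ E] in
/-- The tower vanishes at the origin when every step does. [folklore] -/
theorem towerMap_zero_of_zero {φ : ℕ → E → E} (h0 : ∀ s, φ s 0 = 0) : ∀ T : ℕ, towerMap φ T 0 = 0
  | 0 => rfl
  | T + 1 => by rw [towerMap_succ_apply, towerMap_zero_of_zero h0 T, h0]

/-- The tower is `C²` at the origin when every step is (`C²` at `0`, `φ_s(0) = 0`). [folklore] -/
theorem contDiffAt_towerMap {φ : ℕ → E → E} (h0 : ∀ s, φ s 0 = 0) (hφ : ∀ s, ContDiffAt ℝ 2 (φ s) 0) :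
    ∀ T : ℕ, ContDiffAt ℝ 2 (towerMap φ T) 0
  | 0 => contDiffAt_id
  | T + 1 => by
    have h1 : ContDiffAt ℝ 2 (φ T) (towerMap φ T 0) := by rw [towerMap_zero_of_zero h0 T]; exact hφ T
    exact h1.comp 0 (contDiffAt_towerMap h0 hφ T)

/-- **THE LINEARISED TOWER**: `D(towerMap φ T)(0) = towerLin (s ↦ Dφ_s(0)) 0 T`. [folklore] -/
theorem fderiv_towerMap {φ : ℕ → E → E} (h0 : ∀ s, φ s 0 = 0) (hφ : ∀ s, ContDiffAt ℝ 2 (φ s) 0) :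
    ∀ T : ℕ, fderiv ℝ (towerMap φ T) 0 = towerLin (fun s => fderiv ℝ (φ s) 0) 0 T
  | 0 => by
    rw [towerLin_zero]
    exact fderiv_id
  | T + 1 => by
    have hT0 := towerMap_zero_of_zero h0 T
    have h1 : DifferentiableAt ℝ (φ T) (towerMap φ T 0) := by rw [hT0]; exact (hφ T).differentiableAt (by simp)
    have h2 : DifferentiableAt ℝ (towerMap φ T) 0 := (contDiffAt_towerMap h0 hφ T).differentiableAt (by simp)
    have h : fderiv ℝ (φ T ∘ towerMap φ T) 0 = (fderiv ℝ (φ T) (towerMap φ T 0)).comp (fderiv ℝ (towerMap φ T) 0) :=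
      fderiv_comp (𝕜 := ℝ) (0 : E) h1 h2
    rw [hT0, fderiv_towerMap h0 hφ T] at h
    rw [towerLin_succ, Nat.zero_add]
    exact h

/-- **THE SECOND DERIVATIVE OF THE TOWER IS THE LEVEL SUM OF THE PUSHED-UP ONE-STEP SECOND DERIVATIVES** (see the module docstring):
`D²Ψ_T(0)[x,x′] = Σ_{s<T} towerLin A (s+1) (T−1−s) (D²φ_s(0)[towerLin A 0 s x, towerLin A 0 s x′])`, `A s = Dφ_s(0)`. [folklore] -/
theorem fderiv_fderiv_towerMap {φ : ℕ → E → E} (h0 : ∀ s, φ s 0 = 0) (hφ : ∀ s, ContDiffAt ℝ 2 (φ s) 0) :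
    ∀ (T : ℕ) (x x' : E), fderiv ℝ (fderiv ℝ (towerMap φ T)) 0 x x'
      = ∑ s ∈ range T, towerLin (fun s => fderiv ℝ (φ s) 0) (s + 1) (T - 1 - s)
          (fderiv ℝ (fderiv ℝ (φ s)) 0 (towerLin (fun s => fderiv ℝ (φ s) 0) 0 s x) (towerLin (fun s => fderiv ℝ (φ s) 0) 0 s x'))
  | 0, x, x' => by
    rw [sum_range_zero]
    have h : fderiv ℝ (towerMap φ 0) = fun _ : E => ContinuousLinearMap.id ℝ E := by
      funext y; exact fderiv_id
    show fderiv ℝ (fderiv ℝ (towerMap φ 0)) 0 x x' = 0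
    rw [h, fderiv_const_apply]
    rfl
  | T + 1, x, x' => by
    have hT0 := towerMap_zero_of_zero h0 T
    have h1 : ContDiffAt ℝ 2 (φ T) (towerMap φ T 0) := by rw [hT0]; exact hφ T
    have hcomp := fderiv_fderiv_comp_vec h1 (contDiffAt_towerMap h0 hφ T) x x'
    have hT : (fun y : E => φ T (towerMap φ T y)) = towerMap φ (T + 1) := rfl
    rw [hT, hT0, fderiv_towerMap h0 hφ T, fderiv_fderiv_towerMap h0 hφ T x x'] at hcomp
    rw [hcomp, sum_range_succ, map_sum (fderiv ℝ (φ T) 0), add_comm]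
    congr 1
    · refine sum_congr rfl fun s hs => ?_
      have hs' : s < T := mem_range.mp hs
      have e : T + 1 - 1 - s = (T - 1 - s) + 1 := by omega
      rw [e, towerLin_succ, ContinuousLinearMap.comp_apply, show s + 1 + (T - 1 - s) = T by omega]
    · rw [show T + 1 - 1 - T = 0 by omega, towerLin_zero, ContinuousLinearMap.id_apply]

/-- **COROLLARY — A WEIGHTED LEVEL BOUND FOR A LINEAR FUNCTIONAL OF THE SECOND DERIVATIVE**: if a functional `ℓ` obeys `|ℓ (towerLin A (s+1) (T−1−s) y)| ≤ c·θ^{T−1−s}·q (s+1) y` (the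
push-up from level `s+1` to the top contracts the functional's majorant `q` geometrically) and the one-step second derivatives obey `q (s+1) (D²φ_s(0)[y,y]) ≤ C·p s y` (a local quadratic
bound at level `s`), then `|ℓ (D²Ψ_T(0)[x,x])| ≤ c·C·Σ_{s<T} θ^{T−1−s}·p s (DΨ_s(0) x)` — the shape in which H1's multiplier term is bounded by the straight level masses. [folklore] -/
theorem abs_apply_fderiv_fderiv_towerMap_le {φ : ℕ → E → E} (h0 : ∀ s, φ s 0 = 0) (hφ : ∀ s, ContDiffAt ℝ 2 (φ s) 0)
    (ℓ : E →L[ℝ] ℝ) (q p : ℕ → E → ℝ) {c C θ : ℝ} (hc : 0 ≤ c) (T : ℕ)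
    (hpush : ∀ s < T, ∀ y : E, |ℓ (towerLin (fun s => fderiv ℝ (φ s) 0) (s + 1) (T - 1 - s) y)| ≤ c * θ ^ (T - 1 - s) * q (s + 1) y)
    (hloc : ∀ s < T, ∀ y : E, q (s + 1) (fderiv ℝ (fderiv ℝ (φ s)) 0 y y) ≤ C * p s y)
    (hθ : 0 ≤ θ) (x : E) :
    |ℓ (fderiv ℝ (fderiv ℝ (towerMap φ T)) 0 x x)|
      ≤ c * C * ∑ s ∈ range T, θ ^ (T - 1 - s) * p s (towerLin (fun s => fderiv ℝ (φ s) 0) 0 s x) := by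
  rw [fderiv_fderiv_towerMap h0 hφ T x x, map_sum, mul_sum]
  refine (abs_sum_le_sum_abs _ _).trans (sum_le_sum fun s hs => ?_)
  have hs' : s < T := mem_range.mp hs
  set y := towerLin (fun s => fderiv ℝ (φ s) 0) 0 s x
  refine (hpush s hs' _).trans ?_
  have h2 := hloc s hs' y
  have hθ' : 0 ≤ c * θ ^ (T - 1 - s) := mul_nonneg hc (pow_nonneg hθ _)
  calc c * θ ^ (T - 1 - s) * q (s + 1) (fderiv ℝ (fderiv ℝ (φ s)) 0 y y)
      ≤ c * θ ^ (T - 1 - s) * (C * p s y) := mul_le_mul_of_nonneg_left h2 hθ'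
    _ = c * C * (θ ^ (T - 1 - s) * p s y) := by ring

end Summit.QuantumFields.BalabanUV.T4Continuum.NE7TowerSecondOrderChainRule
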